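import Literature.Analysis.FluidPDE.TaoForcedNormalisedPressure
import Literature.Analysis.FluidPDE.NSWave0
import Literature.Analysis.FluidPDE.RapidDecayLemmas
import HarnessLib

/-!
# Tao's forced unconditional uniqueness, specialised to Clay-class (Schwartz) forcing

T. Tao, *Localisation and compactness properties of the Navier–Stokes global regularity problem*,
Anal. PDE 6 (2013) 25–107 = arXiv:1108.1165 (`Tao2011`), **Corollary 11.4** (arXiv Cor. 71,
p. 36, *Unconditional uniqueness*): "Let `(u₀, f, T)` be smooth `H¹` data. Then there is at most
one almost smooth finite energy solution `(u, p, u₀, f, T)` with this data and with normalised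
pressure." Its forced velocity form is the tree's named fact
`Literature.Analysis.FluidPDE.tao2011_forced_unconditionalUniqueness_velocity`
(`TaoForcedNormalisedPressure.lean`), stated in Tao's printed generality: the force is smooth on
the closed slab `[0, T] × ℝ³` with `‖f‖_{L^∞_t H¹_x([0,T] × ℝ³)} < ∞` (Definition 1.1, p. 3).

Consumers working with Fefferman's Clay classes (cell `pub/ns-blowup`, the E–C bridge
`Summits/NavierStokesRegularity/FluidComputer/PalasekTowerClayBridge.lean`) carry the force as
"`f` smooth on `[0, ∞) × ℝ³` with the space-time decay (5)"
(`Literature.Analysis.FluidPDE.IsSmoothOnHalfSpace`, `Literature.Analysis.FluidPDE.HasRapidSpaceTimeDecay`,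
file `NSWave0.lean`) and the datum as `u₀, ∇u₀ ∈ L²` (`MemLp`). This file PROVES that the named
fact implies that specialisation
(`tao2011_forced_unconditionalUniqueness_velocity.schwartzForce`), so that such consumers can take
the EXISTING fact as their hypothesis instead of restating it. Nothing new is asserted: no
`def … : Prop` is introduced here.

## The bookkeeping proved here

* `HasRapidSpaceTimeDecay.hasUniformRapidDecayOn`: Fefferman's decay (5) (weight
  `(1 + ‖x‖ + t)^K`) implies the tree's uniform-in-time decay `HasUniformRapidDecayOn (Ici 0)`
  (weight `(1 + ‖x‖)^K`), so the slice bounds of `RapidDecayLemmas` apply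
  (`HasUniformRapidDecayOn.norm_le_rpow`, `.norm_fderiv_le_rpow`).
* `lintegral_enorm_sq_le_of_norm_le_mul_rpow`: a bound `‖g x‖ ≤ C (1 + ‖x‖)^{-K}` gives
  `∫ ‖g‖² ≤ C² ∫ (1 + ‖x‖)^{-2K}`, finite for `2K > dim` (Mathlib `finite_integral_one_add_norm`).
* `HasRapidSpaceTimeDecay.exists_lintegral_iteratedFDeriv_slice_sq_le`: hence
  `‖f‖_{L^∞_t H¹_x([0,∞) × E)} < ∞` in the tree's rendering
  `∀ j ≤ 1, ∃ C, ∀ t ≥ 0, ∫⁻ ‖Dʲ(f t)‖ₑ² ≤ C` ("Schwartz implies `H¹`", Tao 2011 §1, p. 3).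
* `lintegral_iteratedFDeriv_sq_lt_top_of_memLp`: `u₀, ∇u₀ ∈ L²` in the same rendering.

## References

* T. Tao, arXiv:1108.1165: Def. 1.1 (p. 3: smooth / `H¹` / finite-energy data), Cor. 11.4
  (arXiv Cor. 71, p. 36). Bib key `Tao2011`.
* C. Fefferman, Clay problem description, (4)–(5), (7).
-/

noncomputable section

open MeasureTheory Set Function
open scoped ENNReal NNReal ContDiff Topology

namespace Literature.Analysis.FluidPDE

/-! ### Fefferman's class (5) inside the tree's uniform-decay class -/

section Decay

variable {E : Type*} [NormedAddCommGroup E] [InnerProductSpace ℝ E]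
  {F : Type*} [NormedAddCommGroup F] [NormedSpace ℝ F]

/-- Smoothness on the closed half-space `[0, ∞) × E` (Fefferman (6)) restricts to smoothness on
every closed slab `[0, T] × E` — Tao's "`f` smooth on `[0,T] × ℝ³`" for smooth data
(Def. 1.1, p. 3). [cite: Tao2011, Def. 1.1 (p. 3)] -/
theorem IsSmoothOnHalfSpace.isSmoothSpaceTimeOn_Icc {w : ℝ → E → F} (hw : IsSmoothOnHalfSpace w)
    (T : ℝ) : IsSmoothSpaceTimeOn (Icc 0 T) w :=
  ContDiffOn.mono hw (prod_mono Icc_subset_Ici_self subset_rfl)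

/-- Fefferman's space-time decay (5), `(1 + ‖x‖ + t)^K ‖Dⁿ f(t, x)‖ ≤ C_{n,K}` on `[0, ∞) × E`,
implies the uniform-in-time spatial decay `HasUniformRapidDecayOn (Ici 0) f`
(`(1 + ‖x‖)^K ‖Dⁿ f(t, x)‖ ≤ C_{n,K}` for `t ≥ 0`), since `1 + ‖x‖ ≤ 1 + ‖x‖ + t`
(Fefferman's force class (5)). [cite: FeffermanClay2006, (5)] -/
theorem HasRapidSpaceTimeDecay.hasUniformRapidDecayOn {f : ℝ → E → F}
    (hf : HasRapidSpaceTimeDecay f) : HasUniformRapidDecayOn (Ici (0 : ℝ)) f := by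
  intro n K
  obtain ⟨C, hC⟩ := hf n K
  refine ⟨C, fun t ht x => ?_⟩
  have h1 : (1 + ‖x‖) ^ K ≤ (1 + ‖x‖ + t) ^ K :=
    pow_le_pow_left₀ (by positivity) (by linarith [mem_Ici.mp ht]) K
  exact (mul_le_mul_of_nonneg_right h1 (norm_nonneg _)).trans (hC t ht x)

end Decay

/-! ### Square-integrability from polynomial decay -/

section Integrals

variable {E : Type*} [NormedAddCommGroup E] [MeasurableSpace E] {μ : Measure E}
  {F : Type*} [NormedAddCommGroup F]

/-- A pointwise bound `‖g x‖ ≤ C (1 + ‖x‖)^{-K}` gives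
`∫ ‖g‖² ≤ C² ∫ (1 + ‖x‖)^{-(K+K)}`; the right side depends only on `C` and `K`
(file-internal plumbing). [folklore] -/
private theorem lintegral_enorm_sq_le_of_norm_le_mul_rpow {g : E → F} {C : ℝ} {K : ℕ}
    (hg : ∀ x, ‖g x‖ ≤ C * (1 + ‖x‖) ^ (-(K : ℝ))) :
    ∫⁻ x, ‖g x‖ₑ ^ 2 ∂μ ≤
      ENNReal.ofReal (C ^ 2) * ∫⁻ x, ENNReal.ofReal ((1 + ‖x‖) ^ (-((K : ℝ) + K))) ∂μ := by
  have hpt : ∀ x : E, ‖g x‖ₑ ^ 2 ≤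
      ENNReal.ofReal (C ^ 2) * ENNReal.ofReal ((1 + ‖x‖) ^ (-((K : ℝ) + K))) := by
    intro x
    have h2 : ‖g x‖ ^ 2 ≤ C ^ 2 * (1 + ‖x‖) ^ (-((K : ℝ) + K)) := by
      calc ‖g x‖ ^ 2 ≤ (C * (1 + ‖x‖) ^ (-(K : ℝ))) ^ 2 :=
            pow_le_pow_left₀ (norm_nonneg _) (hg x) 2
        _ = C ^ 2 * ((1 + ‖x‖) ^ (-(K : ℝ)) * (1 + ‖x‖) ^ (-(K : ℝ))) := by ring
        _ = C ^ 2 * (1 + ‖x‖) ^ (-((K : ℝ) + K)) := by rw [rpow_neg_mul_rpow_neg]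
    rw [← ofReal_norm, ← ENNReal.ofReal_pow (norm_nonneg _), ← ENNReal.ofReal_mul (sq_nonneg _)]
    exact ENNReal.ofReal_le_ofReal h2
  calc ∫⁻ x, ‖g x‖ₑ ^ 2 ∂μ
      ≤ ∫⁻ x, ENNReal.ofReal (C ^ 2) * ENNReal.ofReal ((1 + ‖x‖) ^ (-((K : ℝ) + K))) ∂μ :=
        lintegral_mono hpt
    _ = ENNReal.ofReal (C ^ 2) * ∫⁻ x, ENNReal.ofReal ((1 + ‖x‖) ^ (-((K : ℝ) + K))) ∂μ :=
        lintegral_const_mul' _ _ ENNReal.ofReal_ne_top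

/-- `‖g‖_{L²} < ∞` for `g ∈ L²` (`MemLp g 2`), in the `∫⁻ ‖g‖ₑ² < ∞` rendering
(file-internal plumbing). [folklore] -/
private theorem lintegral_enorm_sq_lt_top_of_memLp_two' {α : Type*} [MeasurableSpace α] {μ' : Measure α}
    {g : α → F} (hg : MemLp g 2 μ') :
    ∫⁻ x, ‖g x‖ₑ ^ 2 ∂μ' < ⊤ := by
  have h := hg.2
  rw [eLpNorm_lt_top_iff_lintegral_rpow_enorm_lt_top two_ne_zero ENNReal.ofNat_ne_top] at h
  simpa [ENNReal.toReal_ofNat] using h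

end Integrals

section SliceIntegrals

variable {E : Type*} [NormedAddCommGroup E] [InnerProductSpace ℝ E] [FiniteDimensional ℝ E]
  [MeasurableSpace E] [BorelSpace E] {μ : Measure E} [μ.IsAddHaarMeasure]
  {F : Type*} [NormedAddCommGroup F] [NormedSpace ℝ F]

/-- **"Schwartz forcing is `L^∞_t H¹_x`"** (Tao 2011, §1, p. 3, for Fefferman's class (5)): a force
smooth on `[0, ∞) × E` with the space-time decay (5) has `‖f(t)‖_{L²}` and `‖∇ₓ f(t)‖_{L²}`
bounded uniformly in `t ≥ 0` — in the tree's rendering of `‖f‖_{L^∞_t H¹_x} < ∞`,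
`∀ j ≤ 1, ∃ C, ∀ t ≥ 0, ∫⁻ ‖Dʲ(f t)‖ₑ² ≤ C` (weight `K = dim E + 1`, so that `(1 + ‖x‖)^{-2K}` is
integrable: Mathlib `finite_integral_one_add_norm`). [cite: Tao2011, §1 p. 3] -/
theorem HasRapidSpaceTimeDecay.exists_lintegral_iteratedFDeriv_slice_sq_le {f : ℝ → E → F}
    (hs : IsSmoothOnHalfSpace f) (hf : HasRapidSpaceTimeDecay f) :
    ∀ j ≤ 1, ∃ C : ℝ≥0, ∀ t, 0 ≤ t → ∫⁻ x, ‖iteratedFDeriv ℝ j (f t) x‖ₑ ^ 2 ∂μ ≤ C := by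
  have hd : HasUniformRapidDecayOn (Ici (0 : ℝ)) f := hf.hasUniformRapidDecayOn
  have hsm : IsSmoothSpaceTimeOn (Ici (0 : ℝ)) f := hs
  set K : ℕ := Module.finrank ℝ E + 1 with hK
  have hr : (Module.finrank ℝ E : ℝ) < (K : ℝ) + K := by
    rw [hK]; push_cast; linarith [(Module.finrank ℝ E).cast_nonneg (α := ℝ)]
  set I : ℝ≥0∞ := ∫⁻ x, ENNReal.ofReal ((1 + ‖x‖) ^ (-((K : ℝ) + K))) ∂μ with hI
  have hItop : I < ⊤ := finite_integral_one_add_norm hr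
  intro j hj
  have hcases : j = 0 ∨ j = 1 := by omega
  rcases hcases with rfl | rfl
  · obtain ⟨C, -, hC⟩ := hd.norm_le_rpow K
    have hB : ENNReal.ofReal (C ^ 2) * I < ⊤ := ENNReal.mul_lt_top ENNReal.ofReal_lt_top hItop
    refine ⟨(ENNReal.ofReal (C ^ 2) * I).toNNReal, fun t ht => ?_⟩
    rw [ENNReal.coe_toNNReal hB.ne]
    have hg : ∀ x, ‖iteratedFDeriv ℝ 0 (f t) x‖ ≤ C * (1 + ‖x‖) ^ (-(K : ℝ)) := fun x => by
      rw [norm_iteratedFDeriv_zero]; exact hC t (mem_Ici.mpr ht) x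
    exact lintegral_enorm_sq_le_of_norm_le_mul_rpow hg
  · obtain ⟨C, -, hC⟩ := hd.norm_fderiv_le_rpow hsm (uniqueDiffOn_Ici 0) K
    have hB : ENNReal.ofReal (C ^ 2) * I < ⊤ := ENNReal.mul_lt_top ENNReal.ofReal_lt_top hItop
    refine ⟨(ENNReal.ofReal (C ^ 2) * I).toNNReal, fun t ht => ?_⟩
    rw [ENNReal.coe_toNNReal hB.ne]
    have hg : ∀ x, ‖iteratedFDeriv ℝ 1 (f t) x‖ ≤ C * (1 + ‖x‖) ^ (-(K : ℝ)) := fun x => by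
      rw [norm_iteratedFDeriv_one]; exact hC t (mem_Ici.mpr ht) x
    exact lintegral_enorm_sq_le_of_norm_le_mul_rpow hg

omit [InnerProductSpace ℝ E] [FiniteDimensional ℝ E] [BorelSpace E] [μ.IsAddHaarMeasure] in
/-- `u₀ ∈ L²`, `∇u₀ ∈ L²` (`MemLp`) is Tao's "`H¹` datum" `‖u₀‖_{H¹_x} < ∞` (Def. 1.1, p. 3) in
the tree's rendering `∀ j ≤ 1, ∫⁻ ‖Dʲu₀‖ₑ² < ∞`. [cite: Tao2011, Def. 1.1 (p. 3)] -/
theorem lintegral_iteratedFDeriv_sq_lt_top_of_memLp [NormedSpace ℝ E] {u₀ : E → F}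
    (h0 : MemLp u₀ 2 μ) (h1 : MemLp (fderiv ℝ u₀) 2 μ) :
    ∀ j ≤ 1, ∫⁻ x, ‖iteratedFDeriv ℝ j u₀ x‖ₑ ^ 2 ∂μ < ⊤ := by
  intro j hj
  have hcases : j = 0 ∨ j = 1 := by omega
  rcases hcases with rfl | rfl
  · refine lt_of_le_of_lt (le_of_eq (lintegral_congr fun x => ?_))
      (lintegral_enorm_sq_lt_top_of_memLp_two' h0)
    rw [← ofReal_norm, ← ofReal_norm, norm_iteratedFDeriv_zero]
  · refine lt_of_le_of_lt (le_of_eq (lintegral_congr fun x => ?_))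
      (lintegral_enorm_sq_lt_top_of_memLp_two' h1)
    rw [← ofReal_norm, ← ofReal_norm, norm_iteratedFDeriv_one]

end SliceIntegrals

/-! ### The specialisation of the named fact -/

/-- **Tao 2011, Cor. 11.4 (arXiv Cor. 71) WITH force — the Clay-class (Schwartz-forcing)
specialisation of the tree's named fact `tao2011_forced_unconditionalUniqueness_velocity`.**
Assuming that fact: for `ν > 0`, `0 < T`, a datum `u₀` with `u₀, ∇u₀ ∈ L²`, a force `f` smooth
on `[0, ∞) × ℝ³` with Fefferman's space-time decay (5), and two classical solutions `(u, p)`,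
`(v, q)` of the forced system on the closed slab `[0, T] × ℝ³` with `u 0 = v 0 = u₀` and finite
energy `sup_{[0,T]} ∫ |u|² < ∞`, `sup_{[0,T]} ∫ |v|² < ∞`, the velocities agree on `[0, T]`.
Proof: the Schwartz force is smooth on the slab and `L^∞_t H¹_x` there
(`HasRapidSpaceTimeDecay.exists_lintegral_iteratedFDeriv_slice_sq_le`), the `MemLp` datum is
`H¹` in the fact's rendering (`lintegral_iteratedFDeriv_sq_lt_top_of_memLp`), and the finite
`ℝ≥0∞` energy bounds are `ℝ≥0` bounds; then apply the fact. This is literally the hypothesis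
`tao_unconditional_uniqueness_velocity_forced` of the E–C bridge
(`Summits/NavierStokesRegularity/FluidComputer/PalasekTowerClayBridge.lean`), which may therefore
be fed the existing Literature fact. [cite: Tao2011, Cor. 11.4 (arXiv Cor. 71), p. 36] -/
theorem tao2011_forced_unconditionalUniqueness_velocity.schwartzForce
    (h : tao2011_forced_unconditionalUniqueness_velocity) :
    ∀ (ν T : ℝ), 0 < ν → 0 < T →
    ∀ (u₀ : EuclideanSpace ℝ (Fin 3) → EuclideanSpace ℝ (Fin 3)),
      MemLp u₀ 2 volume → MemLp (fderiv ℝ u₀) 2 volume →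
    ∀ (f : ℝ → EuclideanSpace ℝ (Fin 3) → EuclideanSpace ℝ (Fin 3)),
      IsSmoothOnHalfSpace f → HasRapidSpaceTimeDecay f →
    ∀ (u v : ℝ → EuclideanSpace ℝ (Fin 3) → EuclideanSpace ℝ (Fin 3))
      (p q : ℝ → EuclideanSpace ℝ (Fin 3) → ℝ),
      IsClassicalNSSolutionOn (Icc 0 T) ν f u p →
      IsClassicalNSSolutionOn (Icc 0 T) ν f v q →
      u 0 = u₀ → v 0 = u₀ →
      (∃ C : ℝ≥0∞, C < ⊤ ∧ ∀ t ∈ Icc 0 T, ∫⁻ x, ‖u t x‖ₑ ^ 2 ≤ C) →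
      (∃ C : ℝ≥0∞, C < ⊤ ∧ ∀ t ∈ Icc 0 T, ∫⁻ x, ‖v t x‖ₑ ^ 2 ≤ C) →
      ∀ t ∈ Icc 0 T, u t = v t := by
  intro ν T hν hT u₀ h₀ h₁ f hfs hfd u v p q hu hv hu0 hv0 hEu hEv t ht
  -- the force: smooth on the slab, `L^∞_t H¹_x` on `[0, ∞)` hence on `[0, T]`
  have hf : IsSmoothSpaceTimeOn (Icc 0 T) f := hfs.isSmoothSpaceTimeOn_Icc T
  have hfH1 : ∀ j ≤ 1, ∃ C : ℝ≥0, ∀ s ∈ Icc 0 T,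
      ∫⁻ x, ‖iteratedFDeriv ℝ j (f s) x‖ₑ ^ 2 ≤ C := by
    intro j hj
    obtain ⟨C, hC⟩ := hfd.exists_lintegral_iteratedFDeriv_slice_sq_le (μ := volume) hfs j hj
    exact ⟨C, fun s hs => hC s hs.1⟩
  -- the datum: `H¹` in the fact's rendering
  have hdat : ∀ j ≤ 1, ∫⁻ x, ‖iteratedFDeriv ℝ j (u 0) x‖ₑ ^ 2 < ⊤ := by
    rw [hu0]; exact lintegral_iteratedFDeriv_sq_lt_top_of_memLp h₀ h₁
  -- the energies: `ℝ≥0∞`-finite bounds are `ℝ≥0` bounds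
  have hE : ∀ {w : ℝ → EuclideanSpace ℝ (Fin 3) → EuclideanSpace ℝ (Fin 3)},
      (∃ C : ℝ≥0∞, C < ⊤ ∧ ∀ s ∈ Icc 0 T, ∫⁻ x, ‖w s x‖ₑ ^ 2 ≤ C) →
      ∃ C : ℝ≥0, ∀ s ∈ Icc 0 T, ∫⁻ x, ‖w s x‖ₑ ^ 2 ≤ C := by
    rintro w ⟨C, hCtop, hC⟩
    exact ⟨C.toNNReal, fun s hs => (hC s hs).trans (ENNReal.coe_toNNReal hCtop.ne).ge⟩
  have hvu : ∀ s ∈ Icc 0 T, v s = u s :=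
    h hν hT hf hfH1 hu hv hdat (hv0.trans hu0.symm) (hE hEu) (hE hEv)
  exact (hvu t ht).symm

end Literature.Analysis.FluidPDE

end
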